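import Literature.NumberTheory.LFunctions.PolyaSignChangesPoleLemmas

/-!
# Pólya's sign-change theorem (Grosswald 1967, Theorem B) — PieceB: the pole nearest to a large
# generic real point

Topic `Literature/NumberTheory/LFunctions` (namespace `Literature.NumberTheory.LFunctions`, grouping
sub-namespace `PolyaSignChanges`).  Part of the moment-method proof of the named fact
`Grosswald1967_thmB` (architecture and `AdmissiblePolePair`: `PolyaSignChangesMomentDefs`; lemmas:
`PolyaSignChangesPoleLemmas`; the parameter arithmetic and `pieceB : PieceB` itself:
`PolyaSignChangesInfiniteHeight`).  Contents:

* §I `nearest_pole_pair` — for `N` meromorphic in normal form around a closed disc with real centre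
  `λ`, analytic at `λ`, real-symmetric near `λ`, with finitely many poles in the disc, all off the
  real axis, at least one strictly inside, and `λ` generic: there is a pole `ρ` (`im ρ > 0`) at
  minimal distance `R > 0` and `R₂ ∈ (R, ϱ]` with `N` analytic and real-symmetric on
  `ball λ R₂ \ {ρ, ρ̄}`, `N ρ = N ρ̄ = 0`;
* §J `stub_nearestPole` (signature verbatim from the A1 skeleton) — under the hypotheses of
  Theorem B, for every `Λ₀` a real `λ ≥ Λ₀` and admissible pole-pair data (for every admissible `x`)
  with `θ − η < re ρ ≤ θ`, `Γ ≤ im ρ`, `(im ρ)² ≤ C λ`.  The pole is the pole of the normal form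
  of `Φ` nearest to `λ`; this treats Grosswald's cases `P ≠ ∅` and `P = ∅` (Pólya's `γ = +∞`, the
  gap closed by Steinig 1969) uniformly.

Printed source of the statement served: Grosswald, TAMS 126 (1967) §4 Theorem B pp. 4–5 (the
bookkeeping here is the cell's own; no printed proof is ported).  Nothing in this file bears on
the truth of RH; no summit statement is proved here.
[cite: Grosswald1967, §4 Thm B pp. 4–5]
-/

noncomputable section

open Complex Set MeasureTheory Filter Topology Metric
open scoped ComplexConjugate

namespace Literature.NumberTheory.LFunctions.PolyaSignChanges

/-! ### I. The clean pole pair around a generic real centre -/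

/-- **Nearest pole pair.**  Let `N` be meromorphic in normal form on `U ⊇ closedBall λ ϱ` (`λ` real),
analytic at `λ` and real-symmetric near `λ`; suppose the (finitely many) poles of `N` in the closed
disc are off the real axis, that there is at least one, and that `λ` is generic (two poles
equidistant from `λ` are equal or conjugate).  Then there are a pole `ρ` with `im ρ > 0` at minimal
distance `R > 0` from `λ` and a radius `R₂ ∈ (R, ϱ]` such that `N` is analytic on
`ball λ R₂ \ {ρ, ρ̄}` and real-symmetric there, with `N ρ = N ρ̄ = 0`.
(auxiliary step of the proof of Theorem B). [cite: Grosswald1967, §4 Thm B pp. 4–5] -/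
theorem nearest_pole_pair {N : ℂ → ℂ} {U : Set ℂ} (hNF : MeromorphicNFOn N U)
    {lam ϱ : ℝ} (hKU : closedBall (lam : ℂ) ϱ ⊆ U)
    (hfin : (closedBall (lam : ℂ) ϱ \ {z | AnalyticAt ℂ N z}).Finite)
    (hne : ∃ q ∈ closedBall (lam : ℂ) ϱ \ {z | AnalyticAt ℂ N z}, ‖(lam : ℂ) - q‖ < ϱ)
    (hlam : AnalyticAt ℂ N lam)
    (hsym : N =ᶠ[𝓝 (lam : ℂ)] fun s => conj (N (conj s)))
    (hoff : ∀ q ∈ closedBall (lam : ℂ) ϱ \ {z | AnalyticAt ℂ N z}, q.im ≠ 0)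
    (hgen : ∀ q ∈ closedBall (lam : ℂ) ϱ \ {z | AnalyticAt ℂ N z},
      ∀ q' ∈ closedBall (lam : ℂ) ϱ \ {z | AnalyticAt ℂ N z},
      ‖(lam : ℂ) - q‖ = ‖(lam : ℂ) - q'‖ → q' = q ∨ q' = conj q) :
    ∃ (ρ : ℂ) (R R₂ : ℝ), ρ ∈ closedBall (lam : ℂ) ϱ ∧ ¬ AnalyticAt ℂ N ρ ∧ 0 < ρ.im ∧
      ‖(lam : ℂ) - ρ‖ = R ∧ 0 < R ∧ R < R₂ ∧ R₂ ≤ ϱ ∧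
      (∀ q ∈ closedBall (lam : ℂ) ϱ, ¬ AnalyticAt ℂ N q → R ≤ ‖(lam : ℂ) - q‖) ∧
      N ρ = 0 ∧ N (conj ρ) = 0 ∧
      AnalyticOnNhd ℂ N (ball (lam : ℂ) R₂ \ {ρ, conj ρ}) ∧
      EqOn N (fun s => conj (N (conj s))) (ball (lam : ℂ) R₂ \ {ρ, conj ρ}) := by
  set Ns : ℂ → ℂ := fun s => conj (N (conj s)) with hNs_def
  have hNs_an : ∀ s : ℂ, AnalyticAt ℂ N (conj s) → AnalyticAt ℂ Ns s := fun s h =>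
    h.conj_conj'
  set PK : Set ℂ := closedBall (lam : ℂ) ϱ \ {z | AnalyticAt ℂ N z} with hPK_def
  -- norm facts for the real centre
  have hnorm_conj : ∀ q : ℂ, ‖(lam : ℂ) - conj q‖ = ‖(lam : ℂ) - q‖ := fun q => by
    rw [← Complex.norm_conj ((lam : ℂ) - q), map_sub, Complex.conj_ofReal]
  have hconj_ball : ∀ {r : ℝ} {z : ℂ}, z ∈ ball (lam : ℂ) r → conj z ∈ ball (lam : ℂ) r := by
    intro r z hz
    rw [mem_ball, dist_eq_norm, norm_sub_rev] at hz ⊢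
    rwa [hnorm_conj]
  -- a nearest pole `ρ₀`
  obtain ⟨q₁, hq₁PK, hq₁ϱ⟩ := hne
  obtain ⟨ρ₀, hρ₀PK, hρ₀min⟩ :=
    Set.exists_min_image PK (fun q => ‖(lam : ℂ) - q‖) hfin ⟨q₁, hq₁PK⟩
  set R : ℝ := ‖(lam : ℂ) - ρ₀‖ with hR_def
  have hRϱ : R < ϱ := lt_of_le_of_lt (hρ₀min q₁ hq₁PK) hq₁ϱ
  have hRpos : 0 < R := by
    rw [hR_def, norm_pos_iff, sub_ne_zero]
    intro h
    exact hρ₀PK.2 (h ▸ hlam)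
  -- the open disc of radius `R` is pole-free and `N` is real-symmetric there
  have hballR : ∀ z ∈ ball (lam : ℂ) R, AnalyticAt ℂ N z := by
    intro z hz
    by_contra hna
    have hz' : ‖(lam : ℂ) - z‖ < R := by rwa [mem_ball, dist_eq_norm, norm_sub_rev] at hz
    have hzK : z ∈ closedBall (lam : ℂ) ϱ := by
      rw [mem_closedBall, dist_eq_norm, norm_sub_rev]; linarith
    have := hρ₀min z ⟨hzK, hna⟩
    linarith
  have hN_ballR : AnalyticOnNhd ℂ N (ball (lam : ℂ) R) := fun z hz => hballR z hz
  have hNs_ballR : AnalyticOnNhd ℂ Ns (ball (lam : ℂ) R) := fun z hz =>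
    hNs_an z (hballR _ (hconj_ball hz))
  have hsymR : EqOn N Ns (ball (lam : ℂ) R) :=
    hN_ballR.eqOn_of_preconnected_of_eventuallyEq hNs_ballR (convex_ball _ _).isPreconnected
      (mem_ball_self hRpos) hsym
  -- conjugates of tied poles are tied poles
  have hT_conj : ∀ q ∈ PK, ‖(lam : ℂ) - q‖ = R → conj q ∈ PK ∧ ‖(lam : ℂ) - conj q‖ = R := by
    intro q hq hqR
    refine ⟨⟨?_, ?_⟩, by rw [hnorm_conj, hqR]⟩
    · have := hq.1
      rw [mem_closedBall, dist_eq_norm, norm_sub_rev] at this ⊢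
      rwa [hnorm_conj]
    · exact not_analyticAt_conj_of_pole hNF hRpos hsymR (hKU hq.1) hqR hq.2
  -- the pole `ρ` with positive imaginary part
  obtain ⟨ρ, hρPK, hρR, hρim⟩ : ∃ ρ : ℂ, ρ ∈ PK ∧ ‖(lam : ℂ) - ρ‖ = R ∧ 0 < ρ.im := by
    rcases lt_or_gt_of_ne (hoff ρ₀ hρ₀PK) with h | h
    · obtain ⟨h1, h2⟩ := hT_conj ρ₀ hρ₀PK rfl
      exact ⟨conj ρ₀, h1, h2, by simpa using h⟩
    · exact ⟨ρ₀, hρ₀PK, rfl, h⟩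
  obtain ⟨hρcPK, hρcR⟩ := hT_conj ρ hρPK hρR
  have hT_sub : ∀ q ∈ PK, ‖(lam : ℂ) - q‖ = R → q = ρ ∨ q = conj ρ := fun q hq hqR =>
    hgen ρ hρPK q hq (by rw [hρR, hqR])
  -- the next radius
  set PK' : Set ℂ := {q ∈ PK | R < ‖(lam : ℂ) - q‖} with hPK'_def
  have hPK'fin : PK'.Finite := hfin.subset (sep_subset _ _)
  set D : Set ℝ := (fun q => ‖(lam : ℂ) - q‖) '' PK' ∪ {ϱ} with hD_def
  have hDfin : D.Finite := (hPK'fin.image _).union (finite_singleton _)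
  obtain ⟨Rn, hRnD, hRnmin⟩ := Set.exists_min_image D id hDfin ⟨ϱ, Or.inr rfl⟩
  simp only [id] at hRnmin
  have hRRn : R < Rn := by
    rcases hRnD with ⟨q, hq, hq'⟩ | h
    · rw [← hq']; exact hq.2
    · rw [mem_singleton_iff] at h; rw [h]; exact hRϱ
  have hRnϱ : Rn ≤ ϱ := hRnmin ϱ (Or.inr rfl)
  have hRnfar : ∀ q ∈ PK, R < ‖(lam : ℂ) - q‖ → Rn ≤ ‖(lam : ℂ) - q‖ := fun q hq h =>
    hRnmin _ (Or.inl ⟨q, ⟨hq, h⟩, rfl⟩)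
  set R₂ : ℝ := (R + Rn) / 2 with hR₂_def
  have hRR₂ : R < R₂ := by rw [hR₂_def]; linarith
  have hR₂Rn : R₂ < Rn := by rw [hR₂_def]; linarith
  -- poles in `ball λ R₂` are `ρ` or `conj ρ`
  have hpoles_R₂ : ∀ z ∈ ball (lam : ℂ) R₂, ¬ AnalyticAt ℂ N z → z = ρ ∨ z = conj ρ := by
    intro z hz hna
    have hz' : ‖(lam : ℂ) - z‖ < R₂ := by rwa [mem_ball, dist_eq_norm, norm_sub_rev] at hz
    have hzK : z ∈ closedBall (lam : ℂ) ϱ := by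
      rw [mem_closedBall, dist_eq_norm, norm_sub_rev]; linarith
    have hzPK : z ∈ PK := ⟨hzK, hna⟩
    rcases (hρ₀min z hzPK).eq_or_lt with h | h
    · exact hT_sub z hzPK h.symm
    · have := hRnfar z hzPK h; linarith
  -- analyticity and symmetry on `W₂ = ball λ R₂ \ {ρ, conj ρ}`
  set W₂ : Set ℂ := ball (lam : ℂ) R₂ \ {ρ, conj ρ} with hW₂_def
  have hNW₂ : AnalyticOnNhd ℂ N W₂ := by
    intro z hz
    by_contra hna
    rcases hpoles_R₂ z hz.1 hna with h | h <;> exact hz.2 (by simp [h])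
  have hNsW₂ : AnalyticOnNhd ℂ Ns W₂ := by
    intro z hz
    apply hNs_an
    by_contra hna
    rcases hpoles_R₂ (conj z) (hconj_ball hz.1) hna with h | h
    · exact hz.2 (by rw [← Complex.conj_conj z, h]; simp)
    · have : z = ρ := by simpa using congrArg conj h
      exact hz.2 (by simp [this])
  have hW₂pc : IsPreconnected W₂ :=
    isPreconnected_ball_diff_of_countable _ _ ((Set.finite_singleton _).insert ρ).countable
  have hlamW₂ : (lam : ℂ) ∈ W₂ := by
    refine ⟨mem_ball_self (by linarith), ?_⟩
    intro h
    simp only [mem_insert_iff, mem_singleton_iff] at h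
    rcases h with h | h
    · have := congrArg Complex.im h; simp at this; linarith
    · have := congrArg Complex.im h; simp at this; linarith
  have hsymW₂ : EqOn N Ns W₂ :=
    hNW₂.eqOn_of_preconnected_of_eventuallyEq hNsW₂ hW₂pc hlamW₂ hsym
  -- values at the poles (normal form)
  have hval : ∀ q ∈ PK, N q = 0 := by
    intro q hq
    have h := hNF (hKU hq.1)
    rw [meromorphicNFAt_iff_analyticAt_or] at h
    rcases h with h | h
    · exact absurd h hq.2
    · exact h.2.2
  exact ⟨ρ, R, R₂, hρPK.1, hρPK.2, hρim, hρR, hRpos, hRR₂, by linarith,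
    fun q hq hna => hρ₀min q ⟨hq, hna⟩, hval ρ hρPK, hval _ hρcPK, hNW₂, hsymW₂⟩

/-! ### J. The nearest pole to a large generic real point (`stub_nearestPole`) -/

/-- **The nearest-pole lemma (PieceB, `stub_nearestPole` of the A1 skeleton, signature verbatim).**
Under the hypotheses of Theorem B there is `C` such that for every `Λ₀` some real `λ ≥ Λ₀` carries
admissible pole-pair data `(λ, x, R', ρ, Ψ)` (for every admissible truncation parameter `x`) whose
pole satisfies `θ − η < re ρ ≤ θ`, `im ρ ≥ Γ`, `(im ρ)² ≤ C·λ`.  Construction: `Ψ` = the normal form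
`N` of `Φ` on `{θ − ε₀ < re}`; a pole `ρ₁` with `re ρ₁ > θ − η₁` (`η₁ = min(η/2, ε₀/2)`) exists by
`exists_pole_near_line`; for `λ ∈ [Λ, Λ+1]` generic (`exists_generic_real`) let `ρ` be a pole in
the disc `|s − λ| ≤ λ − θ + η₁` nearest to `λ` with `im ρ > 0` (`nearest_pole_pair`): the poles at
that distance are exactly `ρ, ρ̄`, the next pole is farther, and real symmetry
`N(s̄) = conj N(s)` on the punctured disc follows from `F(s̄) = conj F(s)` by the identity theorem
on a ball minus two points.  This treats `P ≠ ∅` and Pólya's case `P = ∅` (`γ = +∞`) alike.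
[cite: Grosswald1967, §4 Thm B pp. 4–5] -/
theorem stub_nearestPole (g : ℝ → ℝ) (σ₁ θ ε₀ : ℝ) (Φ : ℂ → ℂ)
    (hint : IntegrableOn (fun x : ℝ => g x * x ^ (-(σ₁ + 1))) (Ioi 1))
    (hθ : θ ≤ σ₁) (hε₀ : 0 < ε₀)
    (hmer : MeromorphicOn Φ {s : ℂ | θ - ε₀ < s.re})
    (hhol : DifferentiableOn ℂ Φ {s : ℂ | θ < s.re})
    (heq : EqOn Φ (Landau.mellinIoi g) {s : ℂ | σ₁ < s.re})
    (hno : ∀ ε : ℝ, 0 < ε → ¬ ∃ Ψ : ℂ → ℂ, DifferentiableOn ℂ Ψ {s : ℂ | θ - ε < s.re} ∧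
        EqOn Ψ (Landau.mellinIoi g) {s : ℂ | σ₁ < s.re})
    (Γ η : ℝ) (hΓ : 0 < Γ) (hη : 0 < η)
    (hbox : DifferentiableOn ℂ Φ {s : ℂ | θ - η < s.re ∧ |s.im| < Γ}) :
    ∃ C : ℝ, ∀ Λ₀ : ℝ, ∃ (lam R' : ℝ) (ρ : ℂ) (Ψ : ℂ → ℂ), Λ₀ ≤ lam ∧
      θ - η < ρ.re ∧ ρ.re ≤ θ ∧ Γ ≤ ρ.im ∧ ρ.im ^ 2 ≤ C * lam ∧
      ∀ x : ℝ, 1 < x → lam ≤ x * (lam - σ₁) →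
        x * Real.exp (1 - x * (lam - σ₁) / lam) * ‖(lam : ℂ) - ρ‖ < lam →
        AdmissiblePolePair g σ₁ lam x R' ρ Ψ := by
  -- ### the normal form `N` of `Φ` on `U = {θ - ε₀ < re}`
  set U : Set ℂ := {s : ℂ | θ - ε₀ < s.re} with hU_def
  have hUo : IsOpen U := Landau.isOpen_re_gt (θ - ε₀)
  set N : ℂ → ℂ := toMeromorphicNFOn Φ U with hN_def
  have hNF : MeromorphicNFOn N U := meromorphicNFOn_toMeromorphicNFOn Φ U
  have hΦan1 : ∀ z : ℂ, θ < z.re → AnalyticAt ℂ Φ z := fun z hz =>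
    hhol.analyticAt ((Landau.isOpen_re_gt θ).mem_nhds hz)
  have hboxo : IsOpen {s : ℂ | θ - η < s.re ∧ |s.im| < Γ} :=
    (isOpen_lt continuous_const Complex.continuous_re).inter
      (isOpen_lt (continuous_abs.comp Complex.continuous_im) continuous_const)
  have hNan1 : ∀ z : ℂ, θ < z.re → AnalyticAt ℂ N z := by
    intro z hz
    refine analyticAt_toMeromorphicNFOn hmer hUo (show θ - ε₀ < z.re by linarith) ?_
    filter_upwards [(Landau.isOpen_re_gt θ).mem_nhds hz] with w hw using hΦan1 w hw
  have hNan2 : ∀ z : ℂ, z ∈ U → θ - η < z.re → |z.im| < Γ → AnalyticAt ℂ N z := by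
    intro z hzU hz1 hz2
    refine analyticAt_toMeromorphicNFOn hmer hUo hzU ?_
    filter_upwards [hboxo.mem_nhds ⟨hz1, hz2⟩] with w hw using
      hbox.analyticAt (hboxo.mem_nhds ⟨hw.1, hw.2⟩)
  have hNF_eq_F : ∀ z : ℂ, σ₁ < z.re → N z = Landau.mellinIoi g z := by
    intro z hz
    have hzθ : θ < z.re := lt_of_le_of_lt hθ hz
    rw [hN_def, toMeromorphicNFOn_apply_of_analyticAt hmer (show θ - ε₀ < z.re by linarith)
      (hΦan1 z hzθ)]
    exact heq hz
  -- real symmetry near every real `λ > σ₁`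
  have hNNs : ∀ lam : ℝ, σ₁ < lam → N =ᶠ[𝓝 (lam : ℂ)] fun s => conj (N (conj s)) := by
    intro lam hlam
    filter_upwards [(Landau.isOpen_re_gt σ₁).mem_nhds (show σ₁ < (lam : ℂ).re by simpa)]
      with z hz
    have hz' : σ₁ < (conj z).re := by simpa using hz
    rw [hNF_eq_F z hz, hNF_eq_F (conj z) hz', mellinIoi_conj, Complex.conj_conj]
  -- ### the reference pole `ρ₁`
  set η₁ : ℝ := min (η / 2) (ε₀ / 2) with hη₁_def
  have hη₁pos : 0 < η₁ := lt_min (by linarith) (by linarith)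
  have hη₁η : η₁ ≤ η / 2 := min_le_left _ _
  have hη₁ε : η₁ ≤ ε₀ / 2 := min_le_right _ _
  obtain ⟨ρ₁, hρ₁re, hρ₁pole⟩ :=
    exists_pole_near_line (η₁ := η₁) hθ hε₀ hmer hhol heq (hno η₁ hη₁pos)
  have hρ₁U : ρ₁ ∈ U := by show θ - ε₀ < ρ₁.re; linarith
  have hρ₁re' : ρ₁.re ≤ θ := by
    by_contra h; push Not at h; exact hρ₁pole (hNan1 ρ₁ h)
  -- ### the constant and, given `Λ₀`, a large generic `λ`
  refine ⟨2 * η₁ + (2 * η₁ * |θ| + 2 * η₁ ^ 2 + ρ₁.im ^ 2), fun Λ₀ => ?_⟩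
  have hc₁ : 0 < ρ₁.re - θ + η₁ := by linarith
  set Λ : ℝ := max (max Λ₀ 1) (max (σ₁ + 1) (ρ₁.re + ρ₁.im ^ 2 / (2 * (ρ₁.re - θ + η₁)) + 1))
    with hΛ_def
  have hΛ₀ : Λ₀ ≤ Λ := le_trans (le_max_left _ _) (le_max_left _ _)
  have hΛ1 : 1 ≤ Λ := le_trans (le_max_right _ _) (le_max_left _ _)
  have hΛσ : σ₁ + 1 ≤ Λ := le_trans (le_max_left _ _) (le_max_right _ _)
  have hΛρ : ρ₁.re + ρ₁.im ^ 2 / (2 * (ρ₁.re - θ + η₁)) + 1 ≤ Λ :=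
    le_trans (le_max_right _ _) (le_max_right _ _)
  -- the compact `Khat ⊆ U` holding every disc we shall look at, and its finite pole set `Q`
  set Khat : Set ℂ := {z : ℂ | θ - η₁ ≤ z.re} ∩ closedBall (Λ : ℂ) (Λ - θ + η₁ + 2) with hKhat
  have hKhatc : IsCompact Khat :=
    (isCompact_closedBall _ _).inter_left (isClosed_le continuous_const Complex.continuous_re)
  have hKhatU : Khat ⊆ U := fun z hz => show θ - ε₀ < z.re by
    have := hz.1; simp only [mem_setOf_eq] at this; linarith
  have hQfin : (Khat \ {z | AnalyticAt ℂ N z}).Finite :=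
    finite_compact_nonanalytic hNF.meromorphicOn hKhatU hKhatc
  obtain ⟨lam, hlamΛ, hlamΛ1, hgen⟩ := exists_generic_real hQfin Λ
  have hlam1 : 1 ≤ lam := le_trans hΛ1 hlamΛ
  have hlamσ : σ₁ < lam := by linarith
  have hlamθ : θ < lam := by linarith
  have hre_ge : ∀ {r : ℝ} {z : ℂ}, z ∈ closedBall (lam : ℂ) r → lam - r ≤ z.re := by
    intro r z hz
    rw [mem_closedBall, dist_eq_norm] at hz
    have h1 : |(z - (lam : ℂ)).re| ≤ ‖z - (lam : ℂ)‖ := Complex.abs_re_le_norm _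
    simp only [sub_re, ofReal_re] at h1
    linarith [neg_abs_le (z.re - lam)]
  -- ### the disc `closedBall λ ϱ`, `ϱ = λ − θ + η₁`
  set ϱ : ℝ := lam - θ + η₁ with hϱ_def
  have hK_Khat : closedBall (lam : ℂ) ϱ ⊆ Khat := by
    intro z hz
    refine ⟨?_, ?_⟩
    · show θ - η₁ ≤ z.re
      have := hre_ge hz; rw [hϱ_def] at this; linarith
    · rw [mem_closedBall, dist_eq_norm] at hz ⊢
      have h1 : ‖(lam : ℂ) - (Λ : ℂ)‖ = lam - Λ := by
        rw [← Complex.ofReal_sub, Complex.norm_real, Real.norm_eq_abs, abs_of_nonneg (by linarith)]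
      calc ‖z - (Λ : ℂ)‖ = ‖(z - lam) + ((lam : ℂ) - Λ)‖ := by ring_nf
        _ ≤ ‖z - lam‖ + ‖(lam : ℂ) - (Λ : ℂ)‖ := norm_add_le _ _
        _ ≤ ϱ + (lam - Λ) := add_le_add hz h1.le
        _ ≤ Λ - θ + η₁ + 2 := by rw [hϱ_def]; linarith
  have hK_U : closedBall (lam : ℂ) ϱ ⊆ U := hK_Khat.trans hKhatU
  have hPKfin : (closedBall (lam : ℂ) ϱ \ {z | AnalyticAt ℂ N z}).Finite :=
    hQfin.subset (Set.sdiff_subset_sdiff_left hK_Khat)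
  -- `ρ₁` lies strictly inside
  have hd₁ : ‖(lam : ℂ) - ρ₁‖ < ϱ := by
    have h3 : ‖(lam : ℂ) - ρ₁‖ ^ 2 < ϱ ^ 2 := by
      rw [Literature.Analysis.DeBrangesSpaces.norm_ofReal_sub_sq, hϱ_def]
      exact ref_pole_in_disc hc₁ (le_trans hΛρ hlamΛ)
    exact lt_of_pow_lt_pow_left₀ 2 (by rw [hϱ_def]; linarith) h3
  have hρ₁PK : ρ₁ ∈ closedBall (lam : ℂ) ϱ \ {z | AnalyticAt ℂ N z} := by
    refine ⟨?_, hρ₁pole⟩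
    rw [mem_closedBall, dist_eq_norm, norm_sub_rev]; exact hd₁.le
  -- poles of the disc: in the strip, left of `θ`, off the box, hence off the real axis
  have hPK_props : ∀ q ∈ closedBall (lam : ℂ) ϱ \ {z | AnalyticAt ℂ N z},
      θ - η < q.re ∧ q.re ≤ θ ∧ Γ ≤ |q.im| := by
    intro q hq
    have h1 : lam - ϱ ≤ q.re := hre_ge hq.1
    have h1' : θ - η < q.re := by rw [hϱ_def] at h1; linarith
    have h2 : q.re ≤ θ := by
      by_contra h; push Not at h; exact hq.2 (hNan1 q h)
    have h3 : Γ ≤ |q.im| := by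
      by_contra h; push Not at h; exact hq.2 (hNan2 q (hK_U hq.1) h1' h)
    exact ⟨h1', h2, h3⟩
  have hoff : ∀ q ∈ closedBall (lam : ℂ) ϱ \ {z | AnalyticAt ℂ N z}, q.im ≠ 0 := by
    intro q hq h0
    have := (hPK_props q hq).2.2
    rw [h0, abs_zero] at this
    linarith
  -- ### the clean pole pair
  obtain ⟨ρ, R, R₂, hρK, hρpole, hρim, hρR, hRpos, hRR₂, hR₂ϱ, hmin, hNρ, hNρc, hNW₂, hsymW₂⟩ :=
    nearest_pole_pair hNF hK_U hPKfin ⟨ρ₁, hρ₁PK, hd₁⟩ (hNan1 _ (by simpa using hlamθ))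
      (hNNs lam hlamσ) hoff
      (fun q hq q' hq' h => hgen q ⟨hK_Khat hq.1, hq.2⟩ q' ⟨hK_Khat hq'.1, hq'.2⟩ h)
  obtain ⟨hρre1, hρre2, hρim'⟩ := hPK_props ρ ⟨hρK, hρpole⟩
  have hρimΓ : Γ ≤ ρ.im := by rwa [abs_of_pos hρim] at hρim'
  have hρU : ρ ∈ U := hK_U hρK
  set R' : ℝ := (R + R₂) / 2 with hR'_def
  have hRR' : R < R' := by rw [hR'_def]; linarith
  have hR'R₂ : R' < R₂ := by rw [hR'_def]; linarith
  have hconj_ball : ∀ {r : ℝ} {z : ℂ}, z ∈ ball (lam : ℂ) r → conj z ∈ ball (lam : ℂ) r := by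
    intro r z hz
    rw [mem_ball, dist_eq_norm] at hz ⊢
    rw [← Complex.norm_conj (z - (lam : ℂ)), map_sub, Complex.conj_ofReal] at hz
    exact hz
  -- ### output
  refine ⟨lam, R', ρ, N, le_trans hΛ₀ hlamΛ, hρre1, hρre2, hρimΓ, ?_, ?_⟩
  · -- height bound from minimality against `ρ₁`
    have h1 : ‖(lam : ℂ) - ρ‖ ^ 2 ≤ ‖(lam : ℂ) - ρ₁‖ ^ 2 :=
      pow_le_pow_left₀ (norm_nonneg _) (by rw [hρR]; exact hmin ρ₁ hρ₁PK.1 hρ₁pole) 2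
    rw [Literature.Analysis.DeBrangesSpaces.norm_ofReal_sub_sq, Literature.Analysis.DeBrangesSpaces.norm_ofReal_sub_sq] at h1
    have hρre0 : lam - ϱ ≤ ρ.re := hre_ge hρK
    rw [hϱ_def] at hρre0
    exact height_bound_of_nearer hlam1 hlamθ.le hη₁pos (by linarith) hρre2 hρ₁re hρ₁re' h1
  · intro x hx1 hx2 hx3
    refine ⟨hint, hlamσ, by linarith, hρim, by linarith, by rw [hρR]; exact hRR', hx1, hx2, hx3,
      ?_, ?_, ?_, ?_⟩
    · -- holomorphy on the closed disc minus the pole pair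
      intro z hz
      exact (hNW₂ z ⟨closedBall_subset_ball hR'R₂ hz.1, hz.2⟩).differentiableAt.differentiableWithinAt
    · -- real symmetry on the closed disc
      intro s hs
      by_cases hsρ : s ∈ ({ρ, conj ρ} : Set ℂ)
      · simp only [mem_insert_iff, mem_singleton_iff] at hsρ
        rcases hsρ with h | h
        · rw [h, hNρc, hNρ, map_zero]
        · rw [h, Complex.conj_conj, hNρ, hNρc, map_zero]
      · have hcsW₂ : conj s ∈ ball (lam : ℂ) R₂ \ {ρ, conj ρ} := by
          refine ⟨hconj_ball (closedBall_subset_ball hR'R₂ hs), ?_⟩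
          intro h
          apply hsρ
          simp only [mem_insert_iff, mem_singleton_iff] at h ⊢
          rcases h with h | h
          · right; rw [← Complex.conj_conj s, h]
          · left; simpa using congrArg conj h
        simpa using hsymW₂ hcsW₂
    · -- agreement with the transform near `λ`
      refine ⟨lam - σ₁, by linarith, fun z hz => hNF_eq_F z ?_⟩
      rw [mem_ball, dist_eq_norm] at hz
      have h1 : |(z - (lam : ℂ)).re| ≤ ‖z - (lam : ℂ)‖ := Complex.abs_re_le_norm _
      simp only [sub_re, ofReal_re] at h1
      linarith [neg_abs_le (z.re - lam), le_abs_self (z.re - lam)]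
    · -- the genuine pole at `ρ`
      obtain ⟨hord, -⟩ := toMeromorphicNFOn_pole hρU hρpole
      have hmero : MeromorphicAt N ρ := (hNF hρU).meromorphicAt
      obtain ⟨n, hn⟩ := WithTop.ne_top_iff_exists.1 hord.ne_top
      have hnneg : n < 0 := by
        rw [← hn] at hord; exact_mod_cast hord
      obtain ⟨h, hh_an, hh_ne, hh_eq⟩ := (meromorphicOrderAt_eq_int_iff hmero).1 hn.symm
      refine ⟨(-n).toNat, by omega, h ρ, hh_ne, ?_⟩
      have hcont : Tendsto h (𝓝[≠] ρ) (𝓝 (h ρ)) :=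
        hh_an.continuousAt.continuousWithinAt.tendsto
      refine hcont.congr' ?_
      filter_upwards [hh_eq, self_mem_nhdsWithin] with z hz hzρ
      rw [hz, smul_eq_mul, ← mul_assoc, ← zpow_natCast, Int.toNat_of_nonneg (by omega),
        ← zpow_add₀ (sub_ne_zero.2 hzρ), neg_add_cancel, zpow_zero, one_mul]

end Literature.NumberTheory.LFunctions.PolyaSignChanges

end
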